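import Summits.Ventures.LatticeQCDFlow.Scaling.StarConveyorRotation
import Summits.Ventures.LatticeQCDFlow.Scaling.HubModeBlocks
import Summits.Ventures.LatticeQCDFlow.Scaling.ReplicaExchangeModeGap
import Summits.Ventures.LatticeQCDFlow.Scaling.FlowHubTauInt

/-!
HONEST FRAMING: exact (Metropolis-corrected) sampling algorithms for lattice gauge theory; figures
of merit are autocorrelation/cost numbers at stated couplings and volumes; no continuum-physics
claim.

# HubModeGap — THE HUB EXCHANGE SCHEME BEATS METASTABILITY WITH ONE-SIDED PERSISTENCE: FOR
# `P = t·GSw + (1−t)·prodKernel w M` OVER A SWAP GRAPH CONTAINING THE HUB EDGES,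
# `Gap ≥ min{C/3, C(1−t)c_w/(3 + C)}` FOR EVERY `C > 0` WITH `C·6m ≤ p tδ₂` AND `C·2(p+6K) ≤ pγ₀(1−t)w_0`
# (`c_w ≤ w_kγ_A`); THE STAR WITH THE BALANCED ALLOCATION `w_0 = ½`, `w_{k+1} = 1/(2K)`:
# `Gap ≥ p(1−t)γ_A·min{tδ₂, γ₀(1−t)}/(224K²)` AND `τ_int(g) ≤ 224K²/(p(1−t)γ_A·min{tδ₂, γ₀(1−t)}) − ½` FOR EVERY
# OBSERVABLE — ORDER `K⁻²`, NO COOLING FACTOR, NO MONOTONICITY (lean-2 GEN-22, ours)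

Venture-side (OURS).  Cell `lqcd-flow` (pub-lqcd), unit `pub-lqcd-lean-2-g22`, 2026-08-26.  Chapter J, file 3:
assembles `Scaling/StarConveyorRotation` (J1: the projection chain's Poincaré constant by rotation paths),
`Scaling/HubModeBlocks` (J2: the block structure of the weighted hub scheme) and the Literature's
Jerrum–Son–Tetali–Vigoda Theorem 1 (PROVED in `MarkovChainDecomposition`) — the hub counterpart of
`Scaling/ReplicaExchangeModeGap` (R3, adjacent ladder: `Gap ≥ p q^K γ_A·min{δ₂/K², γ₀/(K+1)}/(96(K+1)²)`, two-sided
persistence `p`, `q^K`) and `Scaling/ReplicaExchangeModeGapHeating` (R3h, `q`-free on MONOTONE sector ladders).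
Setting: `K+1` levels with positive laws `μ_k`, a partition `mode : S → J` (topological sectors), a swap graph `e` of
`m` edges with distinct endpoints and identity maps containing every hub edge `(0, k+1)`, update weights `w`
(`w_0 > 0`), replica updates `M_k` (row-stochastic, `μ_k`-reversible).  What enters: the within-sector Poincaré
constant `γ_A` of every `M_k` restricted to every sector, the HOT update's Poincaré constant `γ₀` between sectors (its
mode projection; or its global constant, `…_of_hotGap`), the assignment-restricted hub-swap overlap `δ₂`
(`δ₂·min{π̄(m), π̄(m∘τ_k)} ≤ Σ_{mode∘x = m} min{π̃(x), π̃(x∘τ_k)}`), and ONE-SIDED persistence `p·ν_{k+1}(j) ≤ ν_0(j)`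
(heating to the hot level keeps the fraction `p` of every sector's weight).  What does NOT enter: how slowly the cold
replicas cross sectors, any cooling ratio, any monotonicity of the sector weights along the levels.

## What is proved

* §1 **`hubMode_projection_poincare`** — `C·Var_π̄ ≤ 𝓔_π̄(P̄)` for every `C ≥ 0` with `C·6m ≤ p tδ₂` and
  `C·2(p+6K) ≤ pγ₀(1−t)w_0`.
* §2 **`hubMode_spectralGap_ge`** — JSTV: `Gap(P) ≥ min{C/3, C·λ_A/(3 + C)}`, `λ_A = (1−t)c_w`, `c_w ≤ w_kγ_A` (`∀ k`).
* §3 THE BALANCED STAR (`m = K`, `w_0 = ½`, `w_{k+1} = 1/(2K)`; `p, δ₂, γ_A ≤ 1`, `K ≥ 1`, `0 < t < 1`):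
  **`hubModeBalanced_spectralGap_ge`** — `Gap ≥ p(1−t)γ_A·min{tδ₂, γ₀(1−t)}/(224K²)`; `…_of_hotGap` (global hot gap);
  **`hubModeBalanced_tauInt_le`** — hot update irreducible ⇒ for EVERY non-constant observable
  `τ_int(g) ≤ 224K²/(p(1−t)γ_A·min{tδ₂, γ₀(1−t)}) − ½`.

Reading (no numerics implied): on the hub a cold replica's sector is refreshed by one accepted swap with the hot
replica, so metastable cold levels cost the exact sampler ONE power of `K` relative to identical levels
(`Scaling/WeightedHubSchemeFloor`: `Θ(K)`) — the cold replicas must now relax WITHIN their sectors on their own update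
budget (`w_{k+1} = 1/(2K)`) — and only the HEATING persistence of the sector weights; against the ladder's mode-gap
floors the conveyor length and the cooling factor `q^K` are gone.  NOT CLAIMED: a matching `K⁻²` ceiling with modes
(the sector ceilings of `Scaling/ExchangeSchemeSectorCeiling` give `K⁻¹`); sharp constants; transport maps (J4);
general configuration spaces; anything measured.  Literature grade (cell rule): KNOWN MECHANISM (Woodard–Schmidler–
Huber 2009; Madras–Zheng 2003; Jerrum–Son–Tetali–Vigoda 2004), NEW TYPING (hub topology, update allocation, one-sided
persistence, explicit constants); nothing cited as a fact; no new bib keys.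
-/

noncomputable section

open Finset Function
open Literature.Probability.MarkovChains
open Literature.Probability.MarkovChains.Decomposition

namespace Summit.Ventures.LatticeQCDFlow.Scaling

section HubModeGap

variable {S J : Type*} [Fintype S] [DecidableEq S] [Fintype J] [DecidableEq J] {K m : ℕ}
  {μ : Fin (K + 1) → S → ℝ} (hμ : ∀ k x, 0 < μ k x) (hμ1 : ∀ k, ∑ x, μ k x = 1)
  {M : Fin (K + 1) → S → S → ℝ} {w : Fin (K + 1) → ℝ} {mode : S → J} (hmode : Function.Surjective mode) {t : ℝ}
  {e : Fin m → Fin (K + 1) × Fin (K + 1)}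

/-! ## §1 The projection chain: the star conveyor -/

include hμ hμ1 hmode in
/-- **THE PROJECTION CHAIN'S POINCARÉ CONSTANT** (star conveyor with `κ = tδ₂/m`, `ρ = γ₀`, `θ = (1−t)w_0`, one-sided
persistence `p`): for every `C ≥ 0` with `C·6m ≤ p tδ₂` and `C·2(p+6K) ≤ pγ₀(1−t)w_0`, `C·Var_π̄(g) ≤ 𝓔_π̄(P̄; g)`.
[ours] -/
theorem hubMode_projection_poincare (hm : 1 ≤ m) (he : ∀ r, (e r).1 ≠ (e r).2)
    (hhub : ∀ k : Fin K, ∃ j, e j = ((0 : Fin (K + 1)), k.succ)) (hM : ∀ k, IsRowStochastic (M k))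
    (hw0 : ∀ k, 0 ≤ w k) (hw1 : ∑ k, w k = 1) (hwhot : 0 < w 0) (ht0 : 0 < t) (ht1 : t < 1)
    {p δ₂ γ₀ : ℝ} (hp : 0 < p) (hδ0 : 0 < δ₂) (hγ₀ : 0 < γ₀)
    (hpers : ∀ (k : Fin K) (j : J), p * blockMass (μ k.succ) mode j ≤ blockMass (μ 0) mode j)
    (hδ : ∀ (i : Fin (K + 1) → J) (k : Fin K), i ∘ Equiv.swap (0 : Fin (K + 1)) k.succ ≠ i →
      δ₂ * min (blockMass (tensorFun μ) (fun z : Fin (K + 1) → S => mode ∘ z) i)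
          (blockMass (tensorFun μ) (fun z : Fin (K + 1) → S => mode ∘ z) (i ∘ Equiv.swap (0 : Fin (K + 1)) k.succ))
        ≤ ∑ x ∈ block (fun z : Fin (K + 1) → S => mode ∘ z) i,
            min (tensorFun μ x) (tensorFun μ (x ∘ Equiv.swap (0 : Fin (K + 1)) k.succ)))
    (hgap0 : ∀ h : J → ℝ, γ₀ * lawVariance (blockMass (μ 0) mode) h
      ≤ dirichletForm (blockMass (μ 0) mode) (projectionChain (μ 0) (M 0) mode) h)
    {C : ℝ} (hC0 : 0 ≤ C) (hC1 : C * (6 * m) ≤ p * (t * δ₂))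
    (hC2 : C * (2 * (p + 6 * K)) ≤ p * γ₀ * ((1 - t) * w 0)) (g : (Fin (K + 1) → J) → ℝ) :
    C * lawVariance (blockMass (tensorFun μ) (fun z : Fin (K + 1) → S => mode ∘ z)) g
      ≤ dirichletForm (blockMass (tensorFun μ) (fun z : Fin (K + 1) → S => mode ∘ z))
          (projectionChain (tensorFun μ) (fun x y : Fin (K + 1) → S =>
              t * ptGraphSwap μ e (fun _ : Fin m => Equiv.refl S) x y + (1 - t) * prodKernel w M x y)
            (fun z : Fin (K + 1) → S => mode ∘ z)) g := by
  have hlaw : blockMass (tensorFun μ) (fun z : Fin (K + 1) → S => mode ∘ z)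
      = tensorFun (fun k => blockMass (μ k) mode) := funext ptBareMode_blockMass
  have hmpos : (0 : ℝ) < m := Nat.cast_pos.mpr (by omega)
  have hP := weightedScheme_isRowStochastic (t := t) (w := w)
    (ptGraphSwap_isRowStochastic (e := e) (φ := fun _ : Fin m => Equiv.refl S) hμ) hM hw0 hw1 ht0.le ht1.le
  rw [hlaw]
  refine starConveyor_poincare (ν := fun k => blockMass (μ k) mode)
    (Q := projectionChain (tensorFun μ) (fun x y : Fin (K + 1) → S =>
        t * ptGraphSwap μ e (fun _ : Fin m => Equiv.refl S) x y + (1 - t) * prodKernel w M x y)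
      (fun z : Fin (K + 1) → S => mode ∘ z))
    (fun k j => blockMass_pos (hμ k) hmode j) (fun k => by rw [sum_blockMass, hμ1 k]) hp hpers
    (by positivity : 0 < t * δ₂ / m) hγ₀ (mul_pos (by linarith) hwhot : (0 : ℝ) < (1 - t) * w 0)
    (projectionChain_nonneg (fun x => (tensorFun_pos hμ x).le) hP.1 _) ?_ hgap0 ?_ g hC0 ?_ ?_
  · -- star-transposition flows
    intro z k hzk
    exact hubMode_proj_swap (M := M) (w := w) he hhub hμ hmode hM hw0 hw1 ht0.le ht1.le hδ z k hzk
  · -- hot relabels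
    intro z v hv
    exact hubMode_proj_relabel (M := M) (w := w) (e := e) hμ hmode hM hw0 hw1 ht0.le ht1.le z v hv
  · -- `C·6 ≤ p (tδ₂/m)`
    rw [show p * (t * δ₂ / m) = p * (t * δ₂) / m by ring, le_div_iff₀ hmpos]
    calc C * 6 * m = C * (6 * m) := by ring
      _ ≤ p * (t * δ₂) := hC1
  · -- `C·2(p+6K) ≤ p γ₀ ((1−t) w_0)`
    calc C * (2 * (p + 6 * K)) ≤ p * γ₀ * ((1 - t) * w 0) := hC2
      _ = p * γ₀ * ((1 - t) * w 0) := rfl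

/-! ## §2 The spectral gap -/

include hμ hμ1 hmode in
/-- **THE SPECTRAL GAP OF THE WEIGHTED HUB SCHEME FROM WITHIN-SECTOR GAPS, THE HOT REPLICA'S GAP BETWEEN SECTORS,
ASSIGNMENT-RESTRICTED HUB-SWAP OVERLAPS AND ONE-SIDED PERSISTENCE** (Jerrum–Son–Tetali–Vigoda Theorem 1 with mode
assignments as blocks): `Gap(P) ≥ min{C/3, C·λ_A/(3 + C)}`, `λ_A = (1−t)c_w` with `c_w ≤ w_kγ_A` for all `k`, for
every `C > 0` with `C·6m ≤ p tδ₂` and `C·2(p+6K) ≤ pγ₀(1−t)w_0` — NO hypothesis on the cold replicas' barrier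
crossing, NO cooling ratio. [ours] -/
theorem hubMode_spectralGap_ge [Nontrivial S] (hm : 1 ≤ m) (he : ∀ r, (e r).1 ≠ (e r).2)
    (hhub : ∀ k : Fin K, ∃ j, e j = ((0 : Fin (K + 1)), k.succ)) (hM : ∀ k, IsRowStochastic (M k))
    (hMrev : ∀ k, DetailedBalance (μ k) (M k)) (hw0 : ∀ k, 0 ≤ w k) (hw1 : ∑ k, w k = 1) (hwhot : 0 < w 0)
    (ht0 : 0 < t) (ht1 : t < 1) {p δ₂ γ₀ γA cw : ℝ} (hp : 0 < p) (hδ0 : 0 < δ₂) (hγ₀ : 0 < γ₀) (hcw0 : 0 < cw)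
    (hcw : ∀ k, cw ≤ w k * γA)
    (hpers : ∀ (k : Fin K) (j : J), p * blockMass (μ k.succ) mode j ≤ blockMass (μ 0) mode j)
    (hδ : ∀ (i : Fin (K + 1) → J) (k : Fin K), i ∘ Equiv.swap (0 : Fin (K + 1)) k.succ ≠ i →
      δ₂ * min (blockMass (tensorFun μ) (fun z : Fin (K + 1) → S => mode ∘ z) i)
          (blockMass (tensorFun μ) (fun z : Fin (K + 1) → S => mode ∘ z) (i ∘ Equiv.swap (0 : Fin (K + 1)) k.succ))
        ≤ ∑ x ∈ block (fun z : Fin (K + 1) → S => mode ∘ z) i,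
            min (tensorFun μ x) (tensorFun μ (x ∘ Equiv.swap (0 : Fin (K + 1)) k.succ)))
    (hgap0 : ∀ h : J → ℝ, γ₀ * lawVariance (blockMass (μ 0) mode) h
      ≤ dirichletForm (blockMass (μ 0) mode) (projectionChain (μ 0) (M 0) mode) h)
    (hgapA : ∀ k j, ∀ h : S → ℝ, γA * lawVariance (blockLaw (μ k) mode j) h
      ≤ dirichletForm (blockLaw (μ k) mode j) (restrictionChain (M k) mode) h)
    {C : ℝ} (hC0 : 0 < C) (hC1 : C * (6 * m) ≤ p * (t * δ₂))
    (hC2 : C * (2 * (p + 6 * K)) ≤ p * γ₀ * ((1 - t) * w 0)) :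
    min (C / 3) (C * ((1 - t) * cw) / (3 * 1 + C))
      ≤ spectralGap (tensorFun μ) (fun x y : Fin (K + 1) → S =>
          t * ptGraphSwap μ e (fun _ : Fin m => Equiv.refl S) x y + (1 - t) * prodKernel w M x y) := by
  have hQ := ptGraphSwap_isRowStochastic (e := e) (φ := fun _ : Fin m => Equiv.refl S) hμ
  have hP := weightedScheme_isRowStochastic (t := t) (w := w) hQ hM hw0 hw1 ht0.le ht1.le
  exact JerrumEtAl2004_thm_1_spectralGap (tensorFun_pos hμ) (sum_tensorFun_eq_one μ hμ1) hP
    (weightedScheme_detailedBalance (ptGraphSwap_detailedBalance hμ) hMrev t)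
    (modes_surjective hmode) hC0 (mul_pos (by linarith) hcw0) zero_le_one
    (hubMode_projection_poincare hμ hμ1 hmode hm he hhub hM hw0 hw1 hwhot ht0 ht1 hp hδ0 hγ₀ hpers hδ hgap0 hC0.le
      hC1 hC2)
    (fun i f => hubMode_restriction_poincare (e := e) hμ hmode hM hw0 ht0.le ht1.le hcw hgapA i f)
    (fun x => escapeProb_le_one' hP _ x)

/-! ## §3 The balanced star in closed form -/

omit [Fintype S] [DecidableEq S] in
/-- The balanced weight vector `w_0 = ½`, `w_{k+1} = 1/(2K)` is a probability vector (`K ≥ 1`). [ours] -/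
theorem balancedWeight_sum (hK : 1 ≤ K) :
    ∑ k : Fin (K + 1), (if k = 0 then (1 : ℝ) / 2 else 1 / (2 * K)) = 1 := by
  have hK0 : (K : ℝ) ≠ 0 := Nat.cast_ne_zero.mpr (by omega)
  rw [Fin.sum_univ_succ]
  simp only [Fin.succ_ne_zero, if_true, if_false, sum_const, card_univ, Fintype.card_fin, nsmul_eq_mul]
  field_simp
  ring

include hμ hμ1 hmode in
/-- **THE BALANCED STAR: `Gap ≥ p(1−t)γ_A·min{tδ₂, γ₀(1−t)}/(224K²)`** — hub edges `(0, k+1)` only, `w_0 = ½`,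
`w_{k+1} = 1/(2K)`, `0 < t < 1`, `p, δ₂, γ_A ≤ 1`, `K ≥ 1`.  One-sided persistence, within-sector gaps, the hot
replica's gap between sectors and the sector-wise hub-swap overlap; order `K⁻²`. [ours] -/
theorem hubModeBalanced_spectralGap_ge [Nontrivial S] (hK : 1 ≤ K) (hM : ∀ k, IsRowStochastic (M k))
    (hMrev : ∀ k, DetailedBalance (μ k) (M k)) (ht0 : 0 < t) (ht1 : t < 1)
    {p δ₂ γ₀ γA : ℝ} (hp : 0 < p) (hp1 : p ≤ 1) (hδ0 : 0 < δ₂) (hδ1 : δ₂ ≤ 1) (hγ₀ : 0 < γ₀) (hγA : 0 < γA)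
    (hγA1 : γA ≤ 1)
    (hpers : ∀ (k : Fin K) (j : J), p * blockMass (μ k.succ) mode j ≤ blockMass (μ 0) mode j)
    (hδ : ∀ (i : Fin (K + 1) → J) (k : Fin K), i ∘ Equiv.swap (0 : Fin (K + 1)) k.succ ≠ i →
      δ₂ * min (blockMass (tensorFun μ) (fun z : Fin (K + 1) → S => mode ∘ z) i)
          (blockMass (tensorFun μ) (fun z : Fin (K + 1) → S => mode ∘ z) (i ∘ Equiv.swap (0 : Fin (K + 1)) k.succ))
        ≤ ∑ x ∈ block (fun z : Fin (K + 1) → S => mode ∘ z) i,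
            min (tensorFun μ x) (tensorFun μ (x ∘ Equiv.swap (0 : Fin (K + 1)) k.succ)))
    (hgap0 : ∀ h : J → ℝ, γ₀ * lawVariance (blockMass (μ 0) mode) h
      ≤ dirichletForm (blockMass (μ 0) mode) (projectionChain (μ 0) (M 0) mode) h)
    (hgapA : ∀ k j, ∀ h : S → ℝ, γA * lawVariance (blockLaw (μ k) mode j) h
      ≤ dirichletForm (blockLaw (μ k) mode j) (restrictionChain (M k) mode) h) :
    p * (1 - t) * γA * min (t * δ₂) (γ₀ * (1 - t)) / (224 * K ^ 2)
      ≤ spectralGap (tensorFun μ) (fun x y : Fin (K + 1) → S =>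
          t * ptGraphSwap μ (fun k : Fin K => ((0 : Fin (K + 1)), k.succ)) (fun _ : Fin K => Equiv.refl S) x y
            + (1 - t) * prodKernel (fun k : Fin (K + 1) => if k = 0 then (1 : ℝ) / 2 else 1 / (2 * K)) M x y) := by
  have hKr : (1 : ℝ) ≤ K := by exact_mod_cast hK
  have hK0 : (0 : ℝ) < K := by linarith
  have h1t : 0 < 1 - t := by linarith
  set m₀ := min (t * δ₂) (γ₀ * (1 - t)) with hm₀
  have hm₀pos : 0 < m₀ := lt_min (by positivity) (by positivity)
  have hm₀le : m₀ ≤ 1 := (min_le_left _ _).trans (by nlinarith)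
  -- the admissible constant `C = p m₀/(28K)`
  set C := p * m₀ / (28 * K) with hC
  have hCpos : 0 < C := by positivity
  have hw0 : ∀ k : Fin (K + 1), 0 ≤ (if k = 0 then (1 : ℝ) / 2 else 1 / (2 * K)) := fun k => by
    split_ifs <;> positivity
  have hC1 : C * (6 * K) ≤ p * (t * δ₂) := by
    have h1 : m₀ ≤ t * δ₂ := min_le_left _ _
    rw [hC]
    have e : p * m₀ / (28 * K) * (6 * K) = p * m₀ * (6 / 28) := by field_simp
    rw [e]
    nlinarith [mul_le_mul_of_nonneg_left h1 hp.le]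
  have hC2 : C * (2 * (p + 6 * K)) ≤ p * γ₀ * ((1 - t) * (1 / 2 : ℝ)) := by
    have h2 : m₀ ≤ γ₀ * (1 - t) := min_le_right _ _
    have h3 : 2 * (p + 6 * (K : ℝ)) ≤ 14 * K := by nlinarith
    rw [hC]
    calc p * m₀ / (28 * K) * (2 * (p + 6 * K)) ≤ p * m₀ / (28 * K) * (14 * K) :=
          mul_le_mul_of_nonneg_left h3 (by positivity)
      _ = p * m₀ / 2 := by field_simp; ring
      _ ≤ p * (γ₀ * (1 - t)) / 2 := by nlinarith [mul_le_mul_of_nonneg_left h2 hp.le]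
      _ = p * γ₀ * ((1 - t) * (1 / 2 : ℝ)) := by ring
  have hcw : ∀ k : Fin (K + 1), γA / (2 * K) ≤ (if k = 0 then (1 : ℝ) / 2 else 1 / (2 * K)) * γA := by
    intro k
    split_ifs
    · rw [div_le_iff₀ (by positivity)]; nlinarith
    · rw [one_div_mul_eq_div]
  have key := hubMode_spectralGap_ge hμ hμ1 hmode (e := fun k : Fin K => ((0 : Fin (K + 1)), k.succ))
    (w := fun k : Fin (K + 1) => if k = 0 then (1 : ℝ) / 2 else 1 / (2 * K)) hK
    (fun k => (Fin.succ_ne_zero k).symm) (fun k => ⟨k, rfl⟩) hM hMrev hw0 (balancedWeight_sum hK)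
    (by simp : (0 : ℝ) < if (0 : Fin (K + 1)) = 0 then (1 : ℝ) / 2 else 1 / (2 * K)) ht0 ht1 hp hδ0 hγ₀
    (by positivity : 0 < γA / (2 * K)) hcw hpers hδ hgap0 hgapA hCpos hC1 (by simpa using hC2)
  refine le_trans ?_ key
  -- `C ≤ 1/28`, so `min{C/3, C·((1−t)γ_A/(2K))/(3 + C)} ≥ C(1−t)γ_A/(8K) = p(1−t)γ_A m₀/(224K²)`
  have hCle : C ≤ 1 / 28 := by
    rw [hC, div_le_iff₀ (by positivity)]
    have : p * m₀ ≤ 1 := by nlinarith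
    nlinarith
  have hval : p * (1 - t) * γA * m₀ / (224 * K ^ 2) = C * ((1 - t) * γA) / (8 * K) := by
    rw [hC]; field_simp; ring
  rw [hval]
  refine le_min ?_ ?_
  · rw [div_le_div_iff₀ (by positivity) (by norm_num)]
    have : (1 - t) * γA * 3 ≤ 8 * K := by nlinarith [mul_le_one₀ (by linarith : 1 - t ≤ 1) hγA.le hγA1]
    nlinarith [mul_le_mul_of_nonneg_left this hCpos.le]
  · rw [show C * ((1 - t) * (γA / (2 * K))) / (3 * 1 + C) = C * ((1 - t) * γA) / (2 * K * (3 + C)) by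
      field_simp]
    rw [div_le_div_iff₀ (by positivity) (by positivity)]
    have h3 : 2 * K * (3 + C) ≤ 8 * K := by nlinarith
    exact mul_le_mul_of_nonneg_left h3 (by positivity)

include hμ hμ1 hmode in
/-- **The same with the hot replica's GLOBAL gap:** `γ₀·Var_{μ_0} ≤ 𝓔_{μ_0}(M_0)` passes to the mode projection
(`Scaling/SimulatedTemperingModeGap.projection_poincare_of_poincare`). [ours] -/
theorem hubModeBalanced_spectralGap_ge_of_hotGap [Nontrivial S] (hK : 1 ≤ K) (hM : ∀ k, IsRowStochastic (M k))
    (hMrev : ∀ k, DetailedBalance (μ k) (M k)) (ht0 : 0 < t) (ht1 : t < 1)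
    {p δ₂ γ₀ γA : ℝ} (hp : 0 < p) (hp1 : p ≤ 1) (hδ0 : 0 < δ₂) (hδ1 : δ₂ ≤ 1) (hγ₀ : 0 < γ₀) (hγA : 0 < γA)
    (hγA1 : γA ≤ 1)
    (hpers : ∀ (k : Fin K) (j : J), p * blockMass (μ k.succ) mode j ≤ blockMass (μ 0) mode j)
    (hδ : ∀ (i : Fin (K + 1) → J) (k : Fin K), i ∘ Equiv.swap (0 : Fin (K + 1)) k.succ ≠ i →
      δ₂ * min (blockMass (tensorFun μ) (fun z : Fin (K + 1) → S => mode ∘ z) i)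
          (blockMass (tensorFun μ) (fun z : Fin (K + 1) → S => mode ∘ z) (i ∘ Equiv.swap (0 : Fin (K + 1)) k.succ))
        ≤ ∑ x ∈ block (fun z : Fin (K + 1) → S => mode ∘ z) i,
            min (tensorFun μ x) (tensorFun μ (x ∘ Equiv.swap (0 : Fin (K + 1)) k.succ)))
    (hgap0 : ∀ h : S → ℝ, γ₀ * lawVariance (μ 0) h ≤ dirichletForm (μ 0) (M 0) h)
    (hgapA : ∀ k j, ∀ h : S → ℝ, γA * lawVariance (blockLaw (μ k) mode j) h
      ≤ dirichletForm (blockLaw (μ k) mode j) (restrictionChain (M k) mode) h) :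
    p * (1 - t) * γA * min (t * δ₂) (γ₀ * (1 - t)) / (224 * K ^ 2)
      ≤ spectralGap (tensorFun μ) (fun x y : Fin (K + 1) → S =>
          t * ptGraphSwap μ (fun k : Fin K => ((0 : Fin (K + 1)), k.succ)) (fun _ : Fin K => Equiv.refl S) x y
            + (1 - t) * prodKernel (fun k : Fin (K + 1) => if k = 0 then (1 : ℝ) / 2 else 1 / (2 * K)) M x y) :=
  hubModeBalanced_spectralGap_ge hμ hμ1 hmode hK hM hMrev ht0 ht1 hp hp1 hδ0 hδ1 hγ₀ hγA hγA1 hpers hδ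
    (projection_poincare_of_poincare (fun j => (blockMass_pos (hμ 0) hmode j).ne') hgap0) hgapA

include hμ hμ1 hmode in
/-- **EVERY OBSERVABLE: `τ_int(g) ≤ 224K²/(p(1−t)γ_A·min{tδ₂, γ₀(1−t)}) − ½`** for the balanced star with an
irreducible hot update (cold updates, cold laws otherwise arbitrary; one step = one swap attempt or one replica
update): `asympVar(g)/(2Var(g)) ≤ …`. [ours] -/
theorem hubModeBalanced_tauInt_le [Nontrivial S] (hK : 1 ≤ K) (hM : ∀ k, IsRowStochastic (M k))
    (hMrev : ∀ k, DetailedBalance (μ k) (M k)) (hM0 : IsIrreducible (M 0)) (ht0 : 0 < t) (ht1 : t < 1)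
    {p δ₂ γ₀ γA : ℝ} (hp : 0 < p) (hp1 : p ≤ 1) (hδ0 : 0 < δ₂) (hδ1 : δ₂ ≤ 1) (hγ₀ : 0 < γ₀) (hγA : 0 < γA)
    (hγA1 : γA ≤ 1)
    (hpers : ∀ (k : Fin K) (j : J), p * blockMass (μ k.succ) mode j ≤ blockMass (μ 0) mode j)
    (hδ : ∀ (i : Fin (K + 1) → J) (k : Fin K), i ∘ Equiv.swap (0 : Fin (K + 1)) k.succ ≠ i →
      δ₂ * min (blockMass (tensorFun μ) (fun z : Fin (K + 1) → S => mode ∘ z) i)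
          (blockMass (tensorFun μ) (fun z : Fin (K + 1) → S => mode ∘ z) (i ∘ Equiv.swap (0 : Fin (K + 1)) k.succ))
        ≤ ∑ x ∈ block (fun z : Fin (K + 1) → S => mode ∘ z) i,
            min (tensorFun μ x) (tensorFun μ (x ∘ Equiv.swap (0 : Fin (K + 1)) k.succ)))
    (hgap0 : ∀ h : J → ℝ, γ₀ * lawVariance (blockMass (μ 0) mode) h
      ≤ dirichletForm (blockMass (μ 0) mode) (projectionChain (μ 0) (M 0) mode) h)
    (hgapA : ∀ k j, ∀ h : S → ℝ, γA * lawVariance (blockLaw (μ k) mode j) h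
      ≤ dirichletForm (blockLaw (μ k) mode j) (restrictionChain (M k) mode) h)
    {g : (Fin (K + 1) → S) → ℝ} (hg : 0 < lawVariance (tensorFun μ) g) :
    asympVar g (tensorFun μ) (fun x y : Fin (K + 1) → S =>
        t * ptGraphSwap μ (fun k : Fin K => ((0 : Fin (K + 1)), k.succ)) (fun _ : Fin K => Equiv.refl S) x y
          + (1 - t) * prodKernel (fun k : Fin (K + 1) => if k = 0 then (1 : ℝ) / 2 else 1 / (2 * K)) M x y)
      / (2 * lawVariance (tensorFun μ) g)
      ≤ 224 * K ^ 2 / (p * (1 - t) * γA * min (t * δ₂) (γ₀ * (1 - t))) - 1 / 2 := by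
  have hKr : (1 : ℝ) ≤ K := by exact_mod_cast hK
  have hw0 : ∀ k : Fin (K + 1), 0 ≤ (if k = 0 then (1 : ℝ) / 2 else 1 / (2 * K)) := fun k => by
    split_ifs <;> positivity
  have hm : 0 < min (t * δ₂) (γ₀ * (1 - t)) := lt_min (by positivity) (mul_pos hγ₀ (by linarith))
  have hc0 : 0 < p * (1 - t) * γA * min (t * δ₂) (γ₀ * (1 - t)) / (224 * K ^ 2) := by
    have : 0 < 1 - t := by linarith
    positivity
  have h := tauInt_le_of_gapFloor (tensorFun_pos hμ) (sum_tensorFun_eq_one μ hμ1)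
    (weightedScheme_isRowStochastic (ptGraphSwap_isRowStochastic hμ) hM hw0 (balancedWeight_sum hK) ht0.le ht1.le)
    (weightedScheme_detailedBalance (ptGraphSwap_detailedBalance hμ) hMrev t)
    (weightedStar_isIrreducible_of_hot hμ hM hM0 hw0 (balancedWeight_sum hK) (by simp) ht0 ht1) hc0
    (hubModeBalanced_spectralGap_ge hμ hμ1 hmode hK hM hMrev ht0 ht1 hp hp1 hδ0 hδ1 hγ₀ hγA hγA1 hpers hδ hgap0 hgapA)
    hg
  rw [one_div_div] at h
  exact h

end HubModeGap

end Summit.Ventures.LatticeQCDFlow.Scaling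

end
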